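import Mathlib.LinearAlgebra.Matrix.ToLinearEquiv
import Mathlib.LinearAlgebra.Matrix.Block
import Mathlib.Data.Matrix.Mul
import Mathlib.Analysis.SpecialFunctions.Sqrt
import Mathlib.Tactic.Linarith
import Mathlib.Tactic.FinCases
import Mathlib.Tactic.Ring
import HarnessLib

/-!
# Eigenvalues of the Lagrangian Hessian restricted to the tangent subspace (Luenberger–Ye, §10.6)

[LY08] = D. G. Luenberger, Y. Ye, *Linear and Nonlinear Programming* [LuenbergerYe2008], chapter
"Constrained Minimization Conditions" (Ch. 10 in the held copy
`book:luenberger2008-linear-nonlinear-programming`; Ch. 11 of the Springer 2008 printing), §10.6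
"Eigenvalues in tangent subspace": the definition of the restriction `L_M` of the matrix `L` to the
tangent subspace `M = {x : ∇h x = 0}` and of its eigenvectors ("`Ly` can be written as the sum of `λy`
and a vector orthogonal to `M`"), the representation `EᵀLE` in an orthonormal basis `E` of `M`, the
multiplier form `∇h x = 0`, `Lx = λx + ∇hᵀw` and the bordered determinant (26)
`p(λ) = det [[0, ∇h], [−∇hᵀ, L − λI]]`, with Examples 1–3.

Notation: `A : Matrix m n ℝ` stands for `∇h(x*)` (`m` constraints, `n` variables), `L : Matrix n n ℝ`
for the Hessian of the Lagrangian, `M = {x : Ax = 0}`.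

Results recorded:
* `IsTangentEigenpair L A λ x` — `x ∈ M`, `x ≠ 0`, and `Lx − λx ⊥ M` (the definition of the text);
  `isTangentEigenpair_of_multiplier` — the multiplier form `Ax = 0`, `x ≠ 0`, `Lx = λx + Aᵀw`
  gives an eigenpair (the text's "(1) x belongs to M, and (2) Lx = λx + z, where z is orthogonal to
  M", with `z = ∇hᵀw`);
* `bordered_mulVec` / `bordered_det_eq_zero_iff` — (26): the homogeneous system in the unknowns
  `(w, x)` has a nonzero solution iff `p(λ) = det [[0, A], [−Aᵀ, L − λI]] = 0`, and
  `eigen_multiplier_iff_bordered_det` — when the constraint gradients are linearly independent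
  (`Aᵀ` injective, a regular point) this is exactly the existence of an eigenvector `x ≠ 0` in the
  multiplier form;
* `eigen_ETLE_of_multiplier` / `tangent_of_eigen_ETLE` — with `E` an orthonormal basis matrix of `M`
  (`EᵀE = I`, `AE = 0`, `M ⊆ range E`): an `L_M`-eigenpair in multiplier form yields the eigenpair
  `(λ, Eᵀx)` of `EᵀLE`, and an eigenpair `(λ, u)` of `EᵀLE` yields the `L_M`-eigenpair `(λ, Eu)`
  ("The eigenvalues of L restricted to M can be found by determining the eigenvalues of EᵀLE");
* Examples 2–3 (`ex2L`, `ex2A`, `ex2E`): `EᵀLE = [[1, 1], [1, 3]]` (`ex2_ETLE`), its characteristic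
  polynomial `λ² − 4λ + 2` (`ex2_charpoly`), and the bordered determinant of Example 3, evaluated
  block-diagonally, `p(λ) = (1 − λ)(3 − λ) − 1` (`ex3_bordered_det`) — "identical to that found
  earlier"; Example 1 (`ex1L`, `ex1_quadratic_form`): on `M = {y : y₁ + y₂ + y₃ = 0}`,
  `yᵀLy = −(y₁² + y₂² + y₃²)`, so `L_M` acts like the negative of the identity.

The classical Bordered Hessian Test quoted at the end of §10.6 is presented there without proof and
is not transcribed.

Published results only (Lean placement rule): every public declaration carries its
`[cite: LuenbergerYe2008, §10.6 …]` locator.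
-/

namespace Literature.Analysis.Convex.TangentSubspaceEigenvalues

open Matrix

variable {m n k : Type*} [Fintype m] [Fintype n] [Fintype k] [DecidableEq m] [DecidableEq n]
  [DecidableEq k]

/-- **Eigenvector of `L_M` (definition of §10.6).** `x` is an eigenvector of the restriction of `L`
to `M = {x : Ax = 0}` with eigenvalue `λ` if `x ∈ M`, `x ≠ 0`, and `Lx − λx` is orthogonal to `M`.
[cite: LuenbergerYe2008, §10.6 (definition of L_M and its eigenvectors, Figs. 10.4–10.5)] -/
def IsTangentEigenpair (L : Matrix n n ℝ) (A : Matrix m n ℝ) (lam : ℝ) (x : n → ℝ) : Prop :=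
  A *ᵥ x = 0 ∧ x ≠ 0 ∧ ∀ y : n → ℝ, A *ᵥ y = 0 → y ⬝ᵥ (L *ᵥ x - lam • x) = 0

omit [DecidableEq m] [DecidableEq n] in
/-- A vector of the form `∇hᵀw` is orthogonal to `M`. [cite: LuenbergerYe2008, §10.6 Bordered
Hessians ("z is orthogonal to M if and only if z = ∇hᵀw for some w")] -/
theorem transpose_mulVec_orthogonal (A : Matrix m n ℝ) (w : m → ℝ) {y : n → ℝ} (hy : A *ᵥ y = 0) :
    y ⬝ᵥ (Aᵀ *ᵥ w) = 0 := by
  rw [mulVec_transpose, dotProduct_comm, ← dotProduct_mulVec]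
  -- `w ᵥ* A ⬝ᵥ y = w ⬝ᵥ (A *ᵥ y)`
  rw [hy, dotProduct_zero]

omit [DecidableEq m] [DecidableEq n] in
/-- **Multiplier form ⇒ eigenpair.** If `Ax = 0`, `x ≠ 0` and `Lx = λx + Aᵀw` then `(λ, x)` is an
eigenpair of `L_M`. [cite: LuenbergerYe2008, §10.6 Bordered Hessians (conditions (1)–(2) and the
displayed system ∇h x = 0, Lx = λx + ∇hᵀw)] -/
theorem isTangentEigenpair_of_multiplier {L : Matrix n n ℝ} {A : Matrix m n ℝ} {lam : ℝ}
    {x : n → ℝ} {w : m → ℝ} (hx : A *ᵥ x = 0) (hx0 : x ≠ 0) (hL : L *ᵥ x = lam • x + Aᵀ *ᵥ w) :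
    IsTangentEigenpair L A lam x := by
  refine ⟨hx, hx0, fun y hy => ?_⟩
  rw [hL, add_sub_cancel_left]
  exact transpose_mulVec_orthogonal A w hy

/-! ### The bordered determinant (26) -/

/-- The bordered matrix of (26): `[[0, A], [−Aᵀ, L − λI]]`, indexed by `m ⊕ n`.
[cite: LuenbergerYe2008, §10.6 (26)] -/
def bordered (L : Matrix n n ℝ) (A : Matrix m n ℝ) (lam : ℝ) : Matrix (m ⊕ n) (m ⊕ n) ℝ :=
  Matrix.fromBlocks 0 A (-Aᵀ) (L - lam • (1 : Matrix n n ℝ))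

/-- `p(λ)`, the bordered determinant (26). [cite: LuenbergerYe2008, §10.6 (26)] -/
noncomputable def borderedDet (L : Matrix n n ℝ) (A : Matrix m n ℝ) (lam : ℝ) : ℝ :=
  (bordered L A lam).det

omit [DecidableEq m] in
/-- The bordered matrix applied to `(w, x)`: `(Ax, −Aᵀw + (L − λI)x)` — the coefficient matrix of
the homogeneous system of `n + m` equations. [cite: LuenbergerYe2008, §10.6 (system before (26))] -/
theorem bordered_mulVec (L : Matrix n n ℝ) (A : Matrix m n ℝ) (lam : ℝ) (w : m → ℝ) (x : n → ℝ) :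
    bordered L A lam *ᵥ Sum.elim w x = Sum.elim (A *ᵥ x) (-(Aᵀ *ᵥ w) + (L *ᵥ x - lam • x)) := by
  unfold bordered
  rw [fromBlocks_mulVec]
  simp only [Sum.elim_comp_inl, Sum.elim_comp_inr, zero_mulVec, zero_add, neg_mulVec, sub_mulVec,
    smul_mulVec, one_mulVec]

omit [DecidableEq m] in
/-- The system `Ax = 0`, `Lx = λx + Aᵀw` says exactly that `(w, x)` is in the kernel of the bordered
matrix. [cite: LuenbergerYe2008, §10.6 (system before (26))] -/
theorem bordered_mulVec_eq_zero_iff (L : Matrix n n ℝ) (A : Matrix m n ℝ) (lam : ℝ) (w : m → ℝ)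
    (x : n → ℝ) :
    bordered L A lam *ᵥ Sum.elim w x = 0 ↔ A *ᵥ x = 0 ∧ L *ᵥ x = lam • x + Aᵀ *ᵥ w := by
  rw [bordered_mulVec]
  constructor
  · intro h
    have h1 : A *ᵥ x = 0 := by
      funext i; have := congrFun h (Sum.inl i); simpa using this
    have h2 : -(Aᵀ *ᵥ w) + (L *ᵥ x - lam • x) = 0 := by
      funext j; have := congrFun h (Sum.inr j); simpa using this
    refine ⟨h1, ?_⟩
    have : L *ᵥ x - lam • x = Aᵀ *ᵥ w := by
      rw [← sub_eq_zero]; rw [← h2]; abel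
    rw [← this]; abel
  · rintro ⟨h1, h2⟩
    funext i
    rcases i with i | j
    · simp [h1]
    · simp only [Sum.elim_inr, Pi.add_apply, Pi.neg_apply, Pi.sub_apply, Pi.zero_apply, h2,
        Pi.smul_apply]
      ring

/-- **(26).** The homogeneous system in the unknowns `(w, x)` has a nonzero solution iff the
bordered determinant vanishes: `p(λ) = 0`. [cite: LuenbergerYe2008, §10.6 (26) ("It possesses a
nonzero solution if and only if the determinant of the coefficient matrix is zero")] -/
theorem bordered_det_eq_zero_iff (L : Matrix n n ℝ) (A : Matrix m n ℝ) (lam : ℝ) :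
    borderedDet L A lam = 0 ↔
      ∃ w : m → ℝ, ∃ x : n → ℝ, (w ≠ 0 ∨ x ≠ 0) ∧ A *ᵥ x = 0 ∧ L *ᵥ x = lam • x + Aᵀ *ᵥ w := by
  unfold borderedDet
  rw [← Matrix.exists_mulVec_eq_zero_iff]
  constructor
  · rintro ⟨v, hv0, hv⟩
    refine ⟨fun i => v (Sum.inl i), fun j => v (Sum.inr j), ?_, ?_⟩
    · by_contra hcon
      obtain ⟨hw, hx⟩ := not_or.mp hcon
      apply hv0
      funext i
      rcases i with i | j
      · exact congrFun (not_ne_iff.mp hw) i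
      · exact congrFun (not_ne_iff.mp hx) j
    · have hsplit : v = Sum.elim (fun i => v (Sum.inl i)) (fun j => v (Sum.inr j)) := by
        funext i; rcases i with i | j <;> rfl
      rw [hsplit] at hv
      exact (bordered_mulVec_eq_zero_iff L A lam _ _).mp hv
  · rintro ⟨w, x, h0, hx, hL⟩
    refine ⟨Sum.elim w x, ?_, (bordered_mulVec_eq_zero_iff L A lam w x).mpr ⟨hx, hL⟩⟩
    intro hcon
    rcases h0 with hw | hx0
    · exact hw (funext fun i => by simpa using congrFun hcon (Sum.inl i))
    · exact hx0 (funext fun j => by simpa using congrFun hcon (Sum.inr j))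

omit [DecidableEq m] [DecidableEq n] in
/-- At a regular point (`∇h` has linearly independent rows, i.e. `Aᵀ` is injective) a nonzero
solution `(w, x)` of the system has `x ≠ 0`. [cite: LuenbergerYe2008, §10.6 (26) (x an
eigenvector of L_M; regular point §10.2)] -/
theorem x_ne_zero_of_solution {L : Matrix n n ℝ} {A : Matrix m n ℝ} {lam : ℝ} {w : m → ℝ}
    {x : n → ℝ} (hA : Function.Injective fun w : m → ℝ => Aᵀ *ᵥ w) (h0 : w ≠ 0 ∨ x ≠ 0)
    (hL : L *ᵥ x = lam • x + Aᵀ *ᵥ w) : x ≠ 0 := by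
  rcases h0 with hw | hx0
  · intro hx
    apply hw
    apply hA
    simp only
    rw [hx, mulVec_zero, smul_zero, zero_add] at hL
    rw [← hL, mulVec_zero]
  · exact hx0

/-- **`p(λ)` is the characteristic condition of `L_M` (regular point).** If the rows of `∇h` are
linearly independent, then `p(λ) = 0` iff there is an eigenvector `x ≠ 0` of `L_M` with eigenvalue
`λ` in the multiplier form `Ax = 0`, `Lx = λx + Aᵀw`. [cite: LuenbergerYe2008, §10.6 (26) ("It is,
as we have derived, the characteristic polynomial of L_M")] -/
theorem eigen_multiplier_iff_bordered_det (L : Matrix n n ℝ) (A : Matrix m n ℝ) (lam : ℝ)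
    (hA : Function.Injective fun w : m → ℝ => Aᵀ *ᵥ w) :
    borderedDet L A lam = 0 ↔
      ∃ x : n → ℝ, x ≠ 0 ∧ A *ᵥ x = 0 ∧ ∃ w : m → ℝ, L *ᵥ x = lam • x + Aᵀ *ᵥ w := by
  rw [bordered_det_eq_zero_iff]
  constructor
  · rintro ⟨w, x, h0, hx, hL⟩
    exact ⟨x, x_ne_zero_of_solution hA h0 hL, hx, w, hL⟩
  · rintro ⟨x, hx0, hx, w, hL⟩
    exact ⟨w, x, Or.inr hx0, hx, hL⟩

/-! ### The representation `EᵀLE` -/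

omit [DecidableEq m] [DecidableEq n] in
/-- **From `L_M` to `EᵀLE`.** Let `E` (an `n × (n − m)` matrix) satisfy `EᵀE = I` and `AE = 0`
(orthonormal columns lying in `M`) and let every `x ∈ M` be of the form `Eu`.  If `Ax = 0`,
`x ≠ 0`, `Lx = λx + Aᵀw`, then `u = Eᵀx ≠ 0` and `(EᵀLE)u = λu`. [cite: LuenbergerYe2008, §10.6
("The eigenvalues of L restricted to M can be found by determining the eigenvalues of EᵀLE")] -/
theorem eigen_ETLE_of_multiplier {L : Matrix n n ℝ} {A : Matrix m n ℝ} {E : Matrix n k ℝ}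
    (hEE : Eᵀ * E = 1) (hAE : A * E = 0) (hspan : ∀ x : n → ℝ, A *ᵥ x = 0 → ∃ u : k → ℝ, x = E *ᵥ u)
    {lam : ℝ} {x : n → ℝ} {w : m → ℝ} (hx : A *ᵥ x = 0) (hx0 : x ≠ 0)
    (hL : L *ᵥ x = lam • x + Aᵀ *ᵥ w) :
    Eᵀ *ᵥ x ≠ 0 ∧ (Eᵀ * L * E) *ᵥ (Eᵀ *ᵥ x) = lam • (Eᵀ *ᵥ x) := by
  obtain ⟨u, rfl⟩ := hspan x hx
  have hu : Eᵀ *ᵥ (E *ᵥ u) = u := by rw [mulVec_mulVec, hEE, one_mulVec]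
  rw [hu]
  constructor
  · rintro rfl
    exact hx0 (by rw [mulVec_zero])
  · have hEA : Eᵀ *ᵥ (Aᵀ *ᵥ w) = 0 := by
      rw [mulVec_mulVec, ← transpose_mul, hAE, transpose_zero, zero_mulVec]
    calc (Eᵀ * L * E) *ᵥ u = Eᵀ *ᵥ (L *ᵥ (E *ᵥ u)) := by rw [← mulVec_mulVec, ← mulVec_mulVec]
      _ = Eᵀ *ᵥ (lam • (E *ᵥ u) + Aᵀ *ᵥ w) := by rw [hL]
      _ = lam • u := by rw [mulVec_add, hEA, add_zero, mulVec_smul, hu]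

omit [Fintype m] [DecidableEq m] [DecidableEq n] in
/-- **From `EᵀLE` to `L_M`.** With `E` as above (`EᵀE = I`, `AE = 0`, `M ⊆ range E`), an eigenpair
`(λ, u)`, `u ≠ 0`, of `EᵀLE` gives the eigenpair `(λ, Eu)` of `L_M`: `Eu ∈ M`, `Eu ≠ 0`, and
`L(Eu) − λEu` is orthogonal to `M`. [cite: LuenbergerYe2008, §10.6 (representation EᵀLE; "These
eigenvalues are independent of the particular orthonormal basis E")] -/
theorem tangent_of_eigen_ETLE {L : Matrix n n ℝ} {A : Matrix m n ℝ} {E : Matrix n k ℝ}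
    (hEE : Eᵀ * E = 1) (hAE : A * E = 0) (hspan : ∀ x : n → ℝ, A *ᵥ x = 0 → ∃ u : k → ℝ, x = E *ᵥ u)
    {lam : ℝ} {u : k → ℝ} (hu0 : u ≠ 0) (hu : (Eᵀ * L * E) *ᵥ u = lam • u) :
    IsTangentEigenpair L A lam (E *ᵥ u) := by
  refine ⟨by rw [mulVec_mulVec, hAE, zero_mulVec], ?_, fun y hy => ?_⟩
  · intro h
    apply hu0
    have : Eᵀ *ᵥ (E *ᵥ u) = u := by rw [mulVec_mulVec, hEE, one_mulVec]
    rw [← this, h, mulVec_zero]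
  · obtain ⟨v, rfl⟩ := hspan y hy
    -- (Ev)ᵀ(L E u − λ E u) = vᵀ(EᵀLE u − λ EᵀE u) = vᵀ(λu − λu) = 0
    have h1 : (E *ᵥ v) ⬝ᵥ (L *ᵥ (E *ᵥ u) - lam • (E *ᵥ u)) =
        v ⬝ᵥ (Eᵀ *ᵥ (L *ᵥ (E *ᵥ u) - lam • (E *ᵥ u))) := by
      rw [mulVec_transpose, dotProduct_comm v, ← dotProduct_mulVec, dotProduct_comm]
    rw [h1, mulVec_sub, mulVec_smul, mulVec_mulVec, mulVec_mulVec, mulVec_mulVec, hEE, one_mulVec]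
    have : (Eᵀ * L * E) *ᵥ u - lam • u = 0 := by rw [hu, sub_self]
    rw [this, dotProduct_zero]

/-! ### Examples 1–3 -/

/-- Example 1: `L = [[0,1,1],[1,0,1],[1,1,0]]`. [cite: LuenbergerYe2008, §10.6 Example 1; §10.5
Example 1] -/
def ex1L : Matrix (Fin 3) (Fin 3) ℝ := !![0, 1, 1; 1, 0, 1; 1, 1, 0]

/-- **Example 1.** On `M = {y : y₁ + y₂ + y₃ = 0}`: `yᵀLy = −(y₁² + y₂² + y₃²)`, so `L` restricted
to `M` acts like the negative of the identity (`EᵀLE = −I` for any orthonormal basis).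
[cite: LuenbergerYe2008, §10.6 Example 1; §10.5 Example 1 (display)] -/
theorem ex1_quadratic_form (y : Fin 3 → ℝ) (hy : y 0 + y 1 + y 2 = 0) :
    y ⬝ᵥ (ex1L *ᵥ y) = -(y 0 ^ 2 + y 1 ^ 2 + y 2 ^ 2) := by
  have h2 : y 2 = -(y 0 + y 1) := by linarith
  simp [ex1L, mulVec, dotProduct, Fin.sum_univ_three]
  rw [h2]; ring

/-- Example 2: the Lagrangian matrix `L = [[−1,0,0],[0,1,1],[0,1,3]]` at the solution
`x = (1, 0, 0)`, `λ = −1`. [cite: LuenbergerYe2008, §10.6 Example 2] -/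
def ex2L : Matrix (Fin 3) (Fin 3) ℝ := !![-1, 0, 0; 0, 1, 1; 0, 1, 3]

/-- Example 2: `∇h(x*) = (1, 0, 0)` for `h = ½(x₁² + x₂² + x₃²) − 1` at `(1, 0, 0)`, so
`M = {y : y₁ = 0}`. [cite: LuenbergerYe2008, §10.6 Example 2] -/
def ex2A : Matrix (Fin 1) (Fin 3) ℝ := !![1, 0, 0]

/-- Example 2: the orthonormal basis of `M` given by the last two coordinate vectors.
[cite: LuenbergerYe2008, §10.6 Example 2] -/
def ex2E : Matrix (Fin 3) (Fin 2) ℝ := !![0, 0; 1, 0; 0, 1]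

/-- Example 2: `EᵀE = I` and `∇h E = 0`. [cite: LuenbergerYe2008, §10.6 Example 2] -/
theorem ex2E_orthonormal : ex2Eᵀ * ex2E = 1 ∧ ex2A * ex2E = 0 := by
  refine ⟨?_, ?_⟩
  · ext i j
    fin_cases i <;> fin_cases j <;> simp [ex2E, Matrix.mul_apply, Fin.sum_univ_three]
  · ext i j
    fin_cases i; fin_cases j <;> simp [ex2E, ex2A, Matrix.mul_apply, Fin.sum_univ_three]

/-- **Example 2.** `EᵀLE = [[1, 1], [1, 3]]` — the restriction is the corresponding submatrix of
`L`. [cite: LuenbergerYe2008, §10.6 Example 2] -/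
theorem ex2_ETLE : ex2Eᵀ * ex2L * ex2E = !![1, 1; 1, 3] := by
  ext i j
  fin_cases i <;> fin_cases j <;>
    simp [ex2E, ex2L, Matrix.mul_apply, Fin.sum_univ_three]

/-- **Example 2.** The characteristic polynomial of `EᵀLE`:
`det [[1 − λ, 1], [1, 3 − λ]] = λ² − 4λ + 2` (roots `2 ± √2`, both positive: `L_M` is positive
definite). [cite: LuenbergerYe2008, §10.6 Example 2] -/
theorem ex2_charpoly (lam : ℝ) :
    (!![1, 1; 1, 3] - lam • (1 : Matrix (Fin 2) (Fin 2) ℝ)).det = lam ^ 2 - 4 * lam + 2 := by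
  rw [Matrix.det_fin_two]
  simp [Matrix.sub_apply, Matrix.smul_apply]
  ring

/-- The roots `2 ± √2` of `λ² − 4λ + 2`. [cite: LuenbergerYe2008, §10.6 Example 2 ("The
eigenvalues of L_M are thus λ = 2 ± √2")] -/
theorem ex2_roots : (2 + Real.sqrt 2) ^ 2 - 4 * (2 + Real.sqrt 2) + 2 = 0 ∧
    (2 - Real.sqrt 2) ^ 2 - 4 * (2 - Real.sqrt 2) + 2 = 0 := by
  have h : Real.sqrt 2 ^ 2 = 2 := Real.sq_sqrt (by norm_num)
  constructor <;> nlinarith [h]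

/-- **Example 3.** The bordered determinant (26) of Example 2, written block-diagonally over
`(w, x₁) ⊕ (x₂, x₃)`: `p(λ) = det [[0, 1], [−1, −(1+λ)]] · det [[1 − λ, 1], [1, 3 − λ]]
= (1 − λ)(3 − λ) − 1`, "identical to that found earlier". [cite: LuenbergerYe2008, §10.6
Example 3] -/
theorem ex3_bordered_det (lam : ℝ) :
    (Matrix.fromBlocks (!![0, 1; -1, -(1 + lam)] : Matrix (Fin 2) (Fin 2) ℝ) 0 0
      (!![1 - lam, 1; 1, 3 - lam])).det = (1 - lam) * (3 - lam) - 1 := by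
  rw [Matrix.det_fromBlocks_zero₂₁, Matrix.det_fin_two, Matrix.det_fin_two]
  simp

/-- Example 3 agrees with Example 2: `(1 − λ)(3 − λ) − 1 = λ² − 4λ + 2`.
[cite: LuenbergerYe2008, §10.6 Example 3] -/
theorem ex3_eq_ex2 (lam : ℝ) : (1 - lam) * (3 - lam) - 1 = lam ^ 2 - 4 * lam + 2 := by ring

end Literature.Analysis.Convex.TangentSubspaceEigenvalues
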